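import Literature.Geometry.Lorentzian.AsymptoticFlatnessProofs
import Literature.Geometry.Lorentzian.AsymptoticFlatnessChart
import Literature.Geometry.Lorentzian.CoordCurvature
import Literature.MeasureTheory.Hausdorff.SphereArea
import HarnessLib

/-!
# The mass parameter of a strongly asymptotically flat end is its ADM energy

If the data are strongly asymptotically flat on the end `e` with mass parameter `M` in the sense of
Dafermos–Rodnianski, `h_ij = (1 + 2M/r) δ_ij + o₂(r⁻¹)` (`AFEnd.IsStronglyAsymptoticallyFlatDR e D M`,
`AsymptoticFlatness.lean`), then the ADM energy fluxes
`E(r) = (16π)⁻¹ ∮_{S_r} ∑ᵢⱼ (∂ⱼh_ij − ∂ᵢh_jj) xⁱ/r dσ` converge to `M`: `AFEnd.HasADMEnergy e D M`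
(`AFEnd.IsStronglyAsymptoticallyFlatDR.hasADMEnergy`). In particular the mass parameter of the
admissible class `admissibleVacuumData` is the ADM energy of the datum, `AFEnd.admEnergy e D = M`.

Proof (Bartnik 1986, (4.2) evaluated on Schwarzschild; Dafermos–Rodnianski 2013, App. B.2.3; Lee,
*Geometric Relativity*, Exercise 3.12): write `h = q + w` with the model `q = (1 + 2M/r)δ` and the
remainder `w = o₂(r⁻¹)`. The model integrand is computed exactly,
`∑ᵢⱼ (∂ⱼq_ij − ∂ᵢq_jj) xⁱ/r = 4M/r²` on `S_r` (`∂ₗ(2M/r) = −2M xₗ/r³`), so its flux is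
`(16π)⁻¹ · 4πr² · 4M/r² = M` (`μHE[2](S_r) = 4πr²`, `euclideanHausdorffMeasure_sphere_fin_three`);
the remainder integrand is bounded by `18 ‖Dw(x)‖ = o(r⁻²)`, so its flux is `o(1)`.

## References

* R. Bartnik, *The mass of an asymptotically flat manifold*, CPAM 39 (1986), §4, (4.2).
* M. Dafermos, I. Rodnianski, *Lectures on black holes and linear waves*, Clay Math. Proc. 17
  (2013), App. B.2.3.
* D. A. Lee, *Geometric Relativity*, AMS GSM 201 (2019), §3.1.
-/

noncomputable section

-- instance search on the nested operator spaces of metric components and their derivatives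
-- (`E3 →L[ℝ] E3 →L[ℝ] E3 →L[ℝ] ℝ`) is deep and slow on `E3` (as in `AsymptoticFlatnessEnergy`)
set_option maxSynthPendingDepth 3
set_option synthInstance.maxHeartbeats 200000

open Set Filter Asymptotics Bornology Metric MeasureTheory Topology InnerProductSpace
open scoped Real ContDiff RealInnerProductSpace Manifold ENNReal

namespace Literature.Geometry.Lorentzian

open Literature.MeasureTheory.Hausdorff

namespace AFEnd

variable {X : Type*} [TopologicalSpace X] [ChartedSpace E3 X] [IsManifold (𝓡 3) ∞ X]
  (e : AFEnd X) (D : InitialDataSet (𝓡 3) X)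

/-! ### The coordinate derivatives `∂ₗ h_ij` through the Fréchet derivative of `hCoeff` -/

/-- For `R < ‖x‖`, `∂ₗ h_ij(x) = (D(hCoeff)(x) eₗ)(eᵢ, eⱼ)`: the coordinate partial derivative of a
component is the component of the Fréchet derivative (the components are smooth there,
`AFEnd.contDiffAt_hCoeff`). Bartnik 1986, (4.2). [cite: Bartnik1986, §4, (4.2)] -/
theorem partialH_eq_fderiv_hCoeff {x : E3} (hx : e.R < ‖x‖) (l i j : Fin 3) :
    partialH e D l i j x =
      fderiv ℝ (hCoeff e D) x (EuclideanSpace.single l 1) (EuclideanSpace.single i 1)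
        (EuclideanSpace.single j 1) := by
  have hh : DifferentiableAt ℝ (hCoeff e D) x :=
    (contDiffAt_hCoeff e D hx).differentiableAt (by simp)
  unfold partialH
  rw [MetricCoord.fderiv_clm_apply_const (MetricCoord.differentiableAt_clm_apply_const hh _) _,
    MetricCoord.fderiv_clm_apply_const hh]

/-! ### The model term `q = (1 + 2M/r) δ` -/

/-- The Fréchet derivative of the model components `y ↦ (1 + 2M/‖y‖) δ` away from the origin:
`Dq(x) z = −2M ‖x‖⁻³ ⟨x, z⟩ δ` (stated for any constant form `B` in place of `δ`). [folklore] -/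
theorem hasFDerivAt_drModel (B : E3 →L[ℝ] E3 →L[ℝ] ℝ) (M : ℝ) {x : E3} (hx : x ≠ 0) :
    HasFDerivAt (fun y : E3 ↦ (1 + 2 * M / ‖y‖) • B)
      (((2 * M) • ((-(‖x‖ ^ 3)⁻¹) • (innerSL ℝ x : E3 →L[ℝ] ℝ))).smulRight B) x := by
  have h1 : HasFDerivAt (fun y : E3 ↦ 1 + 2 * M * ‖y‖⁻¹)
      ((2 * M) • ((-(‖x‖ ^ 3)⁻¹) • (innerSL ℝ x : E3 →L[ℝ] ℝ))) x :=
    ((hasFDerivAt_inv_norm hx).const_mul (2 * M)).const_add 1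
  have h2 := h1.smul_const B
  refine h2.congr_of_eventuallyEq (Eventually.of_forall fun y ↦ ?_)
  simp only [div_eq_mul_inv]

/-- A trilinear component is bounded by the operator norm: `|(G eₐ)(e_b, e_c)| ≤ ‖G‖` for the
standard unit vectors. [folklore] -/
theorem abs_apply_single_le_opNorm (G : E3 →L[ℝ] E3 →L[ℝ] E3 →L[ℝ] ℝ) (a b c : Fin 3) :
    |G (EuclideanSpace.single a 1) (EuclideanSpace.single b 1) (EuclideanSpace.single c 1)| ≤
      ‖G‖ := by
  have h1 := (G (EuclideanSpace.single a 1) (EuclideanSpace.single b 1)).le_opNorm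
    (EuclideanSpace.single c (1 : ℝ))
  have h2 := (G (EuclideanSpace.single a 1)).le_opNorm (EuclideanSpace.single b (1 : ℝ))
  have h3 := G.le_opNorm (EuclideanSpace.single a (1 : ℝ))
  simp only [PiLp.norm_single, norm_one, mul_one] at h1 h2 h3
  rw [← Real.norm_eq_abs]
  exact h1.trans (h2.trans h3)

/-- **The ADM integrand of a DR-strongly flat end, pointwise**: for `R < ‖x‖`,
`|∑ᵢⱼ (∂ⱼh_ij − ∂ᵢh_jj)(x) xⁱ/‖x‖ − 4M/‖x‖²| ≤ 18 ‖D(h − q)(x)‖` with `q = (1 + 2M/r)δ` (`δ` entered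
as any form `B` with `B(v, w) = ⟨v, w⟩`, to be instantiated with the cast `innerSL ℝ`): the model
term contributes exactly `4M/‖x‖²` (`∂ₗ q_ij = −2M xₗ δ_ij/‖x‖³`, `∑ᵢⱼ(xⱼδᵢⱼ − 3… ) = −2‖x‖²`), and
each of the `18` remainder terms is bounded by `‖D(h − q)(x)‖`. Bartnik 1986, (4.2); Lee 2019,
Exercise 3.12. [cite: Bartnik1986, §4, (4.2)] -/
theorem abs_admIntegrand_sub_le (B : E3 →L[ℝ] E3 →L[ℝ] ℝ) (hB : ∀ v w : E3, B v w = ⟪v, w⟫)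
    {M : ℝ} {x : E3} (hx : e.R < ‖x‖) :
    |∑ i : Fin 3, ∑ j : Fin 3, (partialH e D j i j x - partialH e D i j j x) * x i / ‖x‖ -
        4 * M / ‖x‖ ^ 2| ≤
      18 * ‖fderiv ℝ (fun y ↦ hCoeff e D y - (1 + 2 * M / ‖y‖) • B) x‖ := by
  have hx0 : x ≠ 0 := by
    rintro rfl
    rw [norm_zero] at hx
    exact lt_irrefl _ (hx.trans e.R_pos)
  have hxn : 0 < ‖x‖ := norm_pos_iff.2 hx0
  -- the decomposition `Dh = Dq + G`
  set q : E3 → E3 →L[ℝ] E3 →L[ℝ] ℝ := fun y ↦ (1 + 2 * M / ‖y‖) • B with hq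
  set G := fderiv ℝ (fun y ↦ hCoeff e D y - q y) x with hG
  have hh : DifferentiableAt ℝ (hCoeff e D) x :=
    (contDiffAt_hCoeff e D hx).differentiableAt (by simp)
  have hqd : HasFDerivAt q _ x := hasFDerivAt_drModel B M hx0
  have hsplit : fderiv ℝ (hCoeff e D) x = fderiv ℝ q x + G := by
    rw [hG, fderiv_fun_sub hh hqd.differentiableAt]
    abel
  -- components
  set g : Fin 3 → Fin 3 → Fin 3 → ℝ := fun l i j ↦
    G (EuclideanSpace.single l 1) (EuclideanSpace.single i 1) (EuclideanSpace.single j 1) with hg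
  have hpart : ∀ l i j : Fin 3, partialH e D l i j x =
      2 * M * (-(‖x‖ ^ 3)⁻¹ * x l) * (if j = i then 1 else 0) + g l i j := by
    intro l i j
    rw [partialH_eq_fderiv_hCoeff e D hx, hsplit, hqd.fderiv]
    simp only [hg, add_apply, ContinuousLinearMap.smulRight_apply, smul_apply, innerSL_apply_apply,
      EuclideanSpace.inner_single_right, hB, PiLp.single_apply, smul_eq_mul, conj_trivial, one_mul]
  -- split the sum into model part and remainder part
  have hsum : ∑ i : Fin 3, ∑ j : Fin 3, (partialH e D j i j x - partialH e D i j j x) * x i / ‖x‖ =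
      (∑ i : Fin 3, ∑ j : Fin 3,
        (2 * M * (-(‖x‖ ^ 3)⁻¹ * x j) * (if j = i then (1 : ℝ) else 0) -
          2 * M * (-(‖x‖ ^ 3)⁻¹ * x i)) * x i / ‖x‖) +
      ∑ i : Fin 3, ∑ j : Fin 3, (g j i j - g i j j) * x i / ‖x‖ := by
    rw [← Finset.sum_add_distrib]
    refine Finset.sum_congr rfl fun i _ ↦ ?_
    rw [← Finset.sum_add_distrib]
    refine Finset.sum_congr rfl fun j _ ↦ ?_
    rw [hpart, hpart]
    simp only [if_true]
    ring
  -- the model part is `4M/‖x‖²`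
  have hnorm : x 0 ^ 2 + x 1 ^ 2 + x 2 ^ 2 = ‖x‖ ^ 2 := by
    rw [EuclideanSpace.norm_sq_eq, Fin.sum_univ_three]
    simp only [Real.norm_eq_abs, sq_abs]
  have hmodel : ∑ i : Fin 3, ∑ j : Fin 3,
      (2 * M * (-(‖x‖ ^ 3)⁻¹ * x j) * (if j = i then (1 : ℝ) else 0) -
        2 * M * (-(‖x‖ ^ 3)⁻¹ * x i)) * x i / ‖x‖ = 4 * M / ‖x‖ ^ 2 := by
    simp only [Fin.sum_univ_three, Fin.isValue]
    simp only [show ((0 : Fin 3) = 1) = False by decide, show ((0 : Fin 3) = 2) = False by decide,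
      show ((1 : Fin 3) = 0) = False by decide, show ((1 : Fin 3) = 2) = False by decide,
      show ((2 : Fin 3) = 0) = False by decide, show ((2 : Fin 3) = 1) = False by decide,
      if_true, if_false]
    field_simp
    rw [← hnorm]
    ring
  -- the remainder part is bounded by `18 ‖G‖`
  have hrem : |∑ i : Fin 3, ∑ j : Fin 3, (g j i j - g i j j) * x i / ‖x‖| ≤ 18 * ‖G‖ := by
    have hterm : ∀ i j : Fin 3, |(g j i j - g i j j) * x i / ‖x‖| ≤ 2 * ‖G‖ := by
      intro i j
      rw [abs_div, abs_mul, abs_of_pos hxn]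
      have h1 : |g j i j - g i j j| ≤ 2 * ‖G‖ := by
        have ha := abs_apply_single_le_opNorm G j i j
        have hb := abs_apply_single_le_opNorm G i j j
        calc |g j i j - g i j j| ≤ |g j i j| + |g i j j| := abs_sub _ _
          _ ≤ ‖G‖ + ‖G‖ := add_le_add ha hb
          _ = 2 * ‖G‖ := by ring
      have h2 : |x i| ≤ ‖x‖ := by
        rw [← Real.norm_eq_abs]
        exact PiLp.norm_apply_le x i
      have hG0 : 0 ≤ ‖G‖ := norm_nonneg _
      rw [div_le_iff₀ hxn]
      calc |g j i j - g i j j| * |x i| ≤ 2 * ‖G‖ * ‖x‖ :=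
            mul_le_mul h1 h2 (abs_nonneg _) (by positivity)
        _ = 2 * ‖G‖ * ‖x‖ := rfl
    calc |∑ i : Fin 3, ∑ j : Fin 3, (g j i j - g i j j) * x i / ‖x‖|
        ≤ ∑ i : Fin 3, |∑ j : Fin 3, (g j i j - g i j j) * x i / ‖x‖| :=
          Finset.abs_sum_le_sum_abs _ _
      _ ≤ ∑ i : Fin 3, ∑ j : Fin 3, |(g j i j - g i j j) * x i / ‖x‖| :=
          Finset.sum_le_sum fun i _ ↦ Finset.abs_sum_le_sum_abs _ _
      _ ≤ ∑ _i : Fin 3, ∑ _j : Fin 3, 2 * ‖G‖ :=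
          Finset.sum_le_sum fun i _ ↦ Finset.sum_le_sum fun j _ ↦ hterm i j
      _ = 18 * ‖G‖ := by simp; ring
  rw [hsum, hmodel]
  have : 4 * M / ‖x‖ ^ 2 + ∑ i : Fin 3, ∑ j : Fin 3, (g j i j - g i j j) * x i / ‖x‖ -
      4 * M / ‖x‖ ^ 2 = ∑ i : Fin 3, ∑ j : Fin 3, (g j i j - g i j j) * x i / ‖x‖ := by ring
  rw [this]
  exact hrem

/-! ### Continuity of the flux integrand on far spheres -/

/-- The coordinate derivatives `∂ₗ h_ij` are continuous on the exterior region `{R < ‖x‖}` (the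
components are smooth there, `AFEnd.ContDiffOn_hCoeff_holds`). Bartnik 1986, §4. [cite: Bartnik1986, §4, (4.2)] -/
theorem continuousOn_partialH (l i j : Fin 3) :
    ContinuousOn (partialH e D l i j) {x : E3 | e.R < ‖x‖} := by
  have hU : IsOpen {x : E3 | e.R < ‖x‖} := isOpen_lt continuous_const continuous_norm
  have hc : ContDiffOn ℝ ∞ (fun y ↦ hCoeff e D y (EuclideanSpace.single i 1)
      (EuclideanSpace.single j 1)) {x : E3 | e.R < ‖x‖} :=
    ((ContDiffOn_hCoeff_holds e D).clm_apply contDiffOn_const).clm_apply contDiffOn_const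
  have h1 := (hc.continuousOn_fderiv_of_isOpen hU (by simp)).clm_apply
    (continuousOn_const (c := EuclideanSpace.single l (1 : ℝ)))
  exact h1

/-- The ADM flux integrand `x ↦ ∑ᵢⱼ (∂ⱼh_ij − ∂ᵢh_jj)(x) xⁱ/r` is continuous on the exterior
region. Bartnik 1986, (4.2). [cite: Bartnik1986, §4, (4.2)] -/
theorem continuousOn_admIntegrand (r : ℝ) :
    ContinuousOn (fun x : E3 ↦ ∑ i : Fin 3, ∑ j : Fin 3,
      (partialH e D j i j x - partialH e D i j j x) * x i / r) {x : E3 | e.R < ‖x‖} := by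
  refine continuousOn_finsetSum _ fun i _ ↦ continuousOn_finsetSum _ fun j _ ↦ ?_
  have hxi : Continuous fun x : E3 ↦ x i := (EuclideanSpace.proj i).continuous
  exact (((continuousOn_partialH e D j i j).sub (continuousOn_partialH e D i j j)).mul
    hxi.continuousOn).div_const _

/-! ### The theorem -/

/-- **The mass parameter of a DR-strongly asymptotically flat end is its ADM energy**: if
`h_ij = (1 + 2M/r) δ_ij + o₂(r⁻¹)` on the end `e` (`IsStronglyAsymptoticallyFlatDR e D M`), then the
ADM energy fluxes converge to `M`, `HasADMEnergy e D M`. For `r` beyond the inner radius,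
`|E(r) − M| ≤ (16π)⁻¹ · 4πr² · 18 · sup_{S_r} ‖D(h − q)‖` with `sup_{S_r} ‖D(h − q)‖ = o(r⁻²)`
(`abs_admIntegrand_sub_le`, `μHE[2](S_r) = 4πr²`). Bartnik 1986, (4.2); Dafermos–Rodnianski 2013,
App. B.2.3; Lee 2019, Exercise 3.12. [cite: Bartnik1986, §4, (4.2)] [cite: DafermosRodnianski2013, App. B.2.3] -/
theorem IsStronglyAsymptoticallyFlatDR.hasADMEnergy {e : AFEnd X} {D : InitialDataSet (𝓡 3) X}
    {M : ℝ} (h : IsStronglyAsymptoticallyFlatDR e D M) : HasADMEnergy e D M := by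
  -- the remainder and its first derivative, `‖D(h − q)(x)‖ = o(‖x‖⁻²)`
  set B : E3 →L[ℝ] E3 →L[ℝ] ℝ := (innerSL ℝ : E3 →L[ℝ] E3 →L[ℝ] ℝ) with hB
  have hBvw : ∀ v w : E3, B v w = ⟪v, w⟫ := fun v w ↦ rfl
  set w : E3 → E3 →L[ℝ] E3 →L[ℝ] ℝ := fun y ↦ hCoeff e D y - (1 + 2 * M / ‖y‖) • B with hw
  have hlo : (fun x ↦ ‖fderiv ℝ w x‖) =o[cobounded E3] fun x ↦ (‖x‖ ^ 2)⁻¹ := by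
    have h1 := h.1 1 (by norm_num)
    refine h1.congr' (Eventually.of_forall fun x ↦ norm_iteratedFDeriv_one (f := w) (x := x)) ?_
    filter_upwards [eventually_ne_cobounded (0 : E3)] with x hx
    rw [show (-(1 : ℝ) - ((1 : ℕ) : ℝ)) = -(2 : ℝ) by norm_num, Real.rpow_neg (norm_nonneg x),
      Real.rpow_two]
  rw [HasADMEnergy, Metric.tendsto_atTop]
  intro ε hε
  -- far radius beyond which `‖Dw(x)‖ ≤ (ε/9) ‖x‖⁻²`
  have hε9 : 0 < ε / 9 := by positivity
  obtain ⟨R₂, -, hR₂⟩ := hasBasis_cobounded_norm.eventually_iff.1 (hlo.def hε9)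
  set r₀ : ℝ := max (max e.R 1) R₂ + 1 with hr₀
  refine ⟨r₀, fun r hr ↦ ?_⟩
  have hrR : e.R < r := by
    have : e.R ≤ max (max e.R 1) R₂ := (le_max_left _ _).trans (le_max_left _ _)
    linarith
  have hr1 : 1 ≤ r := by
    have : (1 : ℝ) ≤ max (max e.R 1) R₂ := (le_max_right _ _).trans (le_max_left _ _)
    linarith
  have hrR₂ : R₂ ≤ r := by
    have : R₂ ≤ max (max e.R 1) R₂ := le_max_right _ _
    linarith
  have hr0 : 0 < r := by linarith
  set μ : Measure E3 := μHE[2] with hμ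
  set S : Set E3 := sphere 0 r with hS
  set I : E3 → ℝ := fun x ↦ ∑ i : Fin 3, ∑ j : Fin 3,
    (partialH e D j i j x - partialH e D i j j x) * x i / r with hI
  have hμS : μ S = ENNReal.ofReal (4 * Real.pi * r ^ 2) :=
    euclideanHausdorffMeasure_sphere_fin_three hr0
  have hμS' : μ S < ⊤ := by rw [hμS]; exact ENNReal.ofReal_lt_top
  have hμSr : μ.real S = 4 * Real.pi * r ^ 2 := by
    rw [measureReal_def, hμS, ENNReal.toReal_ofReal (by positivity)]
  have hSO : S ⊆ {x : E3 | e.R < ‖x‖} := fun x hx ↦ by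
    rw [hS, mem_sphere_zero_iff_norm] at hx
    show e.R < ‖x‖
    rw [hx]; exact hrR
  -- pointwise bound on the sphere
  have hbd : ∀ x ∈ S, ‖I x - 4 * M / r ^ 2‖ ≤ 18 * (ε / 9) / r ^ 2 := by
    intro x hx
    have hxr : ‖x‖ = r := by rwa [hS, mem_sphere_zero_iff_norm] at hx
    have hxR : e.R < ‖x‖ := hSO hx
    have hpt := abs_admIntegrand_sub_le e D B hBvw (M := M) hxR
    rw [hxr] at hpt
    have hDw : ‖fderiv ℝ w x‖ ≤ ε / 9 / r ^ 2 := by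
      have h2 := hR₂ (show R₂ ≤ ‖x‖ by rw [hxr]; exact hrR₂)
      rw [Real.norm_of_nonneg (norm_nonneg _), Real.norm_of_nonneg (by positivity), hxr] at h2
      rw [div_eq_mul_inv]
      exact h2
    rw [Real.norm_eq_abs]
    calc |I x - 4 * M / r ^ 2| ≤ 18 * ‖fderiv ℝ w x‖ := hpt
      _ ≤ 18 * (ε / 9 / r ^ 2) := by gcongr
      _ = 18 * (ε / 9) / r ^ 2 := by ring
  -- integrability on the sphere
  have hIc : ContinuousOn I S := (continuousOn_admIntegrand e D r).mono hSO
  have hIm : AEStronglyMeasurable I (μ.restrict S) :=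
    hIc.aestronglyMeasurable isClosed_sphere.measurableSet
  have hIint : IntegrableOn I S μ := by
    refine IntegrableOn.of_bound hμS' hIm (|4 * M / r ^ 2| + 18 * (ε / 9) / r ^ 2) ?_
    rw [ae_restrict_iff' isClosed_sphere.measurableSet]
    refine Eventually.of_forall fun x hx ↦ ?_
    have h := hbd x hx
    rw [Real.norm_eq_abs] at h ⊢
    have := abs_sub_abs_le_abs_sub (I x) (4 * M / r ^ 2)
    linarith
  have hcint : IntegrableOn (fun _ : E3 ↦ 4 * M / r ^ 2) S μ := integrableOn_const hμS'.ne
  -- split the flux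
  have hsplit : ∫ x in S, I x ∂μ = (∫ x in S, (I x - 4 * M / r ^ 2) ∂μ) + 16 * Real.pi * M := by
    rw [integral_sub hIint hcint, setIntegral_const, hμSr]
    have h16 : (4 * Real.pi * r ^ 2) • (4 * M / r ^ 2) = 16 * Real.pi * M := by
      rw [smul_eq_mul]
      field_simp
      ring
    rw [h16]
    ring
  have herr : ‖∫ x in S, (I x - 4 * M / r ^ 2) ∂μ‖ ≤ 18 * (ε / 9) / r ^ 2 * (4 * Real.pi * r ^ 2) := by
    rw [← hμSr]
    exact norm_setIntegral_le_of_norm_le_const hμS' hbd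
  -- conclusion
  rw [Real.dist_eq]
  change |(16 * Real.pi)⁻¹ * ∫ x in S, I x ∂μ - M| < ε
  rw [hsplit]
  set J : ℝ := ∫ x in S, (I x - 4 * M / r ^ 2) ∂μ with hJ
  have hJ' : (16 * Real.pi)⁻¹ * (J + 16 * Real.pi * M) - M = (16 * Real.pi)⁻¹ * J := by
    field_simp
    ring
  rw [hJ', abs_mul, abs_of_pos (by positivity)]
  rw [Real.norm_eq_abs] at herr
  calc (16 * Real.pi)⁻¹ * |J|
      ≤ (16 * Real.pi)⁻¹ * (18 * (ε / 9) / r ^ 2 * (4 * Real.pi * r ^ 2)) :=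
        mul_le_mul_of_nonneg_left herr (by positivity)
    _ = ε / 2 := by
        field_simp
        ring
    _ < ε := by linarith

/-- **The ADM energy of a DR-strongly asymptotically flat end is its mass parameter**,
`admEnergy e D = M` (`limUnder` form of `IsStronglyAsymptoticallyFlatDR.hasADMEnergy`).
Dafermos–Rodnianski 2013, App. B.2.3. [cite: DafermosRodnianski2013, App. B.2.3] -/
theorem IsStronglyAsymptoticallyFlatDR.admEnergy_eq {e : AFEnd X} {D : InitialDataSet (𝓡 3) X}
    {M : ℝ} (h : IsStronglyAsymptoticallyFlatDR e D M) : admEnergy e D = M :=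
  h.hasADMEnergy.admEnergy_eq

/-- **The mass parameter of a CK-strongly asymptotically flat end is its ADM energy** (the
Christodoulou–Klainerman rates imply the Dafermos–Rodnianski ones). Christodoulou–Klainerman 1993,
(1.0.9). [cite: ChristodoulouKlainerman1993, (1.0.9)] -/
theorem IsStronglyAsymptoticallyFlatCK.hasADMEnergy {e : AFEnd X} {D : InitialDataSet (𝓡 3) X}
    {M : ℝ} (h : IsStronglyAsymptoticallyFlatCK e D M) : HasADMEnergy e D M :=
  h.isStronglyAsymptoticallyFlatDR.hasADMEnergy

end AFEnd

end Literature.Geometry.Lorentzian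

end
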